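import Literature.NumberTheory.EllipticCurves.BSDQuadraticDescentProofs
import Mathlib.NumberTheory.NumberField.Discriminant.Different
import Mathlib.NumberTheory.RamificationInertia.Unramified
import HarnessLib

/-!
# The local polynomial of `E^{(d_K)}` at a ramified prime of good reduction is `1`

Let `E / ℚ` be an elliptic curve (model `W`), `K` a quadratic field of discriminant `d_K`, and `v`
a finite place of `ℚ` (prime `p`) with `p ∣ d_K` (i.e. `p` ramified in `K`) at which `E` has good
reduction. Then Mathlib's local polynomial of the quadratic twist `E^{(d_K)}`
(`WeierstrassCurve.quadraticTwist`) at `v` is trivial: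

`L_v(E^{(d_K)}, T) = 1`   (`localPolynomialAt_quadraticTwist_discr_eq_one_of_dvd`),

hence so is its local Euler factor (`localEulerFactor_quadraticTwist_discr_eq_one_of_dvd`) — at
*every* ramified prime including `p = 2`, which the valuation arguments of
`QuadraticTwistKroneckerLFunctionProofs` (odd `p`) and `QuadraticTwistOddValuationReductionProofs`
(`ord₂(d_K)` odd) do not reach when `d_K = 4m`, `m ≡ 3 (mod 4)`.

Proof: by the tree's Artin formalism for a quadratic base change
(`WeierstrassCurve.localPolynomialAt_baseChange_quadratic`, `ArtinFormalismQuadraticLocalProofs`,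
ramified case: `L_w(E_K, T) = L_v(E, T) · L_v(E^{(d_K)}, T)` for the unique place `w ∣ v` of `K`,
`f(w|v) = 1`), a degree count: `deg L_w ≤ 2` and `deg L_v(E) = 2` (good reduction), so the factor
`L_v(E^{(d_K)})` is constant, with constant coefficient `1`. That `v` falls in the ramified case of
`placesOver_trichotomy_of_finrank_eq_two` is Dedekind's discriminant theorem (Mathlib
`NumberField.not_dvd_discr_iff_isUnramifiedIn`: `p ∣ d_K` iff some prime above `p` is ramified over
`ℤ`), transported from `ℤ` to `𝓞 ℚ` by the tower law `e(𝔓|ℤ) = e(𝔓 ∩ 𝓞 ℚ|ℤ) · e(𝔓|𝓞 ℚ)`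
(`Ideal.ramificationIdx_tower`) with `e(𝔓 ∩ 𝓞 ℚ|ℤ) = 1` (`discr ℚ = 1`).

Everything is proved; no definitions and no named facts.

## References

* K. Ireland, M. Rosen, *A Classical Introduction to Modern Number Theory*, 2nd ed. (1990), Ch. 20
  §5, Prop. 20.5.4(b). [IrelandRosen1990]
* J. H. Silverman, *The Arithmetic of Elliptic Curves*, 2nd ed. (2009), App. C §16.
-/

noncomputable section

open scoped Classical NumberField

namespace WeierstrassCurve

open IsDedekindDomain NumberField Polynomial Rat.HeightOneSpectrum
  Literature.NumberTheory.EllipticCurves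

/-! ### Degrees of local polynomials -/

section Degree

variable {R : Type*} [CommRing R] [IsDomain R] [IsDiscreteValuationRing R] {L : Type*} [Field L]
  [Algebra R L] [IsFractionRing R L] (X : WeierstrassCurve L)

/-- Mathlib's local polynomial has degree `≤ 2` (it is `1 − aT + qT²`, `1 ∓ T` or `1`). [folklore] -/
theorem natDegree_localPolynomial_le_two : (X.localPolynomial R).natDegree ≤ 2 := by
  unfold localPolynomial
  split_ifs
  · compute_degree
  · compute_degree!
  · compute_degree!
  · simp

/-- At a place of good reduction with finite residue field the local polynomial
`1 − aT + qT²` has degree exactly `2` (`q = #k ≠ 0`). [folklore] -/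
theorem natDegree_localPolynomial_of_hasGoodReduction [Finite (IsLocalRing.ResidueField R)]
    (h : (X.minimal R).HasGoodReduction R) : (X.localPolynomial R).natDegree = 2 := by
  have hq : Nat.card (IsLocalRing.ResidueField R) ≠ 0 := (Nat.card_pos (α := IsLocalRing.ResidueField R)).ne'
  refine le_antisymm (natDegree_localPolynomial_le_two X) (le_natDegree_of_ne_zero ?_)
  unfold localPolynomial
  rw [if_pos h]
  simp [coeff_one, hq]

end Degree

/-! ### A prime dividing `d_K` is ramified in the quadratic field `K` (over `𝓞 ℚ`) -/

section Ramified

variable (K : Type) [Field K] [NumberField K]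

/-- **Dedekind's discriminant theorem, read at a place of `𝓞 ℚ`.** If the prime `p` under the
finite place `v` of `ℚ` divides `d_K`, some place `w ∣ v` of `K` has ramification index
`e(w|v) ≠ 1` over `𝓞 ℚ` (Mathlib `NumberField.not_dvd_discr_iff_isUnramifiedIn` over `ℤ`, the tower
law `Ideal.ramificationIdx_tower` along `ℤ → 𝓞 ℚ → 𝓞 K`, and `e = 1` for the primes of `𝓞 ℚ` over
`ℤ` as `discr ℚ = 1`). [folklore] -/
theorem exists_place_ramificationIdx_ne_one_of_dvd_discr (v : HeightOneSpectrum (𝓞 ℚ))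
    (hv : ((primesEquiv v : ℕ) : ℤ) ∣ NumberField.discr K) :
    ∃ w : HeightOneSpectrum (𝓞 K), w.asIdeal.under (𝓞 ℚ) = v.asIdeal ∧
      w.asIdeal.ramificationIdx (𝓞 ℚ) ≠ 1 := by
  set p : ℕ := (primesEquiv v : ℕ) with hpdef
  have hpP : p.Prime := (primesEquiv v).2
  have hp : Prime (p : ℤ) := Nat.prime_iff_prime_int.mp hpP
  have hp0 : (Ideal.span {(p : ℤ)} : Ideal ℤ) ≠ ⊥ := by
    rw [Ne, Ideal.span_singleton_eq_bot]; exact_mod_cast hpP.ne_zero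
  -- some prime `𝔓` of `𝓞 K` over `(p)` is ramified over `ℤ`
  have hram : ¬ Algebra.IsUnramifiedIn (𝓞 K) (Ideal.span {(p : ℤ)}) :=
    fun h ↦ ((NumberField.not_dvd_discr_iff_isUnramifiedIn K (𝓞 K) hp).mpr h) hv
  rw [Algebra.isUnramifiedIn_iff_forall_ramificationIdx_eq_one] at hram
  push Not at hram
  obtain ⟨𝔓, h𝔓prime, hover, he⟩ := hram
  haveI := h𝔓prime
  haveI := hover
  have h𝔓0 : 𝔓 ≠ ⊥ := Ideal.ne_bot_of_liesOver_of_ne_bot hp0 𝔓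
  set w : HeightOneSpectrum (𝓞 K) := ⟨𝔓, h𝔓prime, h𝔓0⟩ with hw
  -- the prime of `𝓞 ℚ` under `𝔓` is unramified over `ℤ` (`discr ℚ = 1`)
  set q : Ideal (𝓞 ℚ) := 𝔓.under (𝓞 ℚ) with hq
  haveI : q.LiesOver (Ideal.span {(p : ℤ)}) := by
    rw [Ideal.liesOver_iff, hq, Ideal.under_under, ← Ideal.liesOver_iff]
    exact hover
  have hq1 : q.ramificationIdx ℤ = 1 := by
    have hunr : Algebra.IsUnramifiedIn (𝓞 ℚ) (Ideal.span {(p : ℤ)}) :=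
      (NumberField.not_dvd_discr_iff_isUnramifiedIn ℚ (𝓞 ℚ) hp).mp (by
        rw [NumberField.discr_rat]
        exact fun h ↦ hpP.one_lt.ne' (by exact_mod_cast Int.eq_one_of_dvd_one (by norm_num) h))
    haveI : q.IsPrime := Ideal.IsPrime.under (𝓞 ℚ) 𝔓
    exact hunr.ramificationIdx_eq_one inferInstance
  -- tower law: `e(𝔓|ℤ) = e(q|ℤ) · e(𝔓|𝓞 ℚ)`
  have htower := Ideal.ramificationIdx_tower (R := ℤ) q 𝔓
  rw [hq1, one_mul] at htower
  -- `q = v.asIdeal`: both are the prime of `𝓞 ℚ` over `p`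
  have hpq : ((p : ℕ) : 𝓞 ℚ) ∈ q := by
    rw [hq, Ideal.under_def, Ideal.mem_comap, map_natCast]
    have h1 : ((p : ℤ) : 𝓞 K) ∈ 𝔓 := by
      have := (Ideal.mem_of_liesOver 𝔓 (Ideal.span {(p : ℤ)}) (p : ℤ)).mp
        (Ideal.mem_span_singleton_self (p : ℤ))
      simpa using this
    simpa using h1
  have hqv : q = v.asIdeal := by
    haveI hqprime : q.IsPrime := Ideal.IsPrime.under (𝓞 ℚ) 𝔓
    have hq0 : q ≠ ⊥ := by
      intro h0
      rw [h0] at hpq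
      exact hpP.ne_zero (by exact_mod_cast (Ideal.mem_bot.mp hpq))
    set v' : HeightOneSpectrum (𝓞 ℚ) := ⟨q, hqprime, hq0⟩ with hv'
    have hgen : natGenerator v' ∣ p := by
      refine (natGenerator_dvd_iff v').mpr ?_
      have h := Ideal.mem_map_of_mem (Rat.IsIntegralClosure.intEquiv (𝓞 ℚ)) hpq
      rwa [map_natCast] at h
    have hgen' : natGenerator v' = p := (Nat.prime_dvd_prime_iff_eq (prime_natGenerator v') hpP).mp hgen
    have hvv : v' = v := primesEquiv.injective (Subtype.ext hgen')
    exact congrArg HeightOneSpectrum.asIdeal hvv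
  refine ⟨w, hqv, ?_⟩
  rw [← htower]
  exact he

/-- **A prime dividing `d_K` falls in the ramified case of the decomposition trichotomy**: for a
quadratic field `K` and the place `v` of `ℚ` under a prime `p ∣ d_K`, there is a unique place `w`
of `K` above `v`, with `f(w|v) = 1` (and `e(w|v) = 2`) (Marcus, *Number Fields*, Ch. 3, Thm. 25).
[folklore] -/
theorem exists_unique_place_of_dvd_discr (h2 : Module.finrank ℚ K = 2) (v : HeightOneSpectrum (𝓞 ℚ))
    (hv : ((primesEquiv v : ℕ) : ℤ) ∣ NumberField.discr K) :
    ∃ w : HeightOneSpectrum (𝓞 K), w.asIdeal.under (𝓞 ℚ) = v.asIdeal ∧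
      (∀ w' : HeightOneSpectrum (𝓞 K), w'.asIdeal.under (𝓞 ℚ) = v.asIdeal → w' = w) ∧
      w.asIdeal.inertiaDeg (𝓞 ℚ) = 1 := by
  obtain ⟨w, hw, hne⟩ := exists_place_ramificationIdx_ne_one_of_dvd_discr K v hv
  have hwv : w.under (𝓞 ℚ) = v := HeightOneSpectrum.ext hw
  rcases placesOver_trichotomy_of_finrank_eq_two K h2 v with
    ⟨w₁, w₂, -, -, hef⟩ | ⟨w₀, hset, he1, -⟩ | ⟨w₀, hset, -, hf1⟩
  · exact absurd (hef w hwv).1 hne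
  · exfalso
    have hmem : w ∈ ({w' : HeightOneSpectrum (𝓞 K) | w'.under (𝓞 ℚ) = v} : Set _) := hwv
    rw [hset, Set.mem_singleton_iff] at hmem
    rw [hmem] at hne
    exact hne he1
  · have hw₀ : w₀ ∈ ({w' : HeightOneSpectrum (𝓞 K) | w'.under (𝓞 ℚ) = v} : Set _) := by
      rw [hset]; exact Set.mem_singleton w₀
    refine ⟨w₀, congrArg HeightOneSpectrum.asIdeal hw₀, fun w' hw' ↦ ?_, hf1⟩
    have hmem : w' ∈ ({w' : HeightOneSpectrum (𝓞 K) | w'.under (𝓞 ℚ) = v} : Set _) :=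
      HeightOneSpectrum.ext hw'
    rw [hset, Set.mem_singleton_iff] at hmem
    exact hmem

end Ramified

/-! ### `L_v(E^{(d_K)}, T) = 1` at a ramified prime of good reduction -/

section Twist

variable (W : WeierstrassCurve ℚ) [W.IsElliptic] (K : Type) [Field K] [NumberField K]

/-- **`L_v(E^{(d_K)}, T) = 1` at a ramified prime of good reduction** (any `p`, including `2`):
for a quadratic field `K`, a prime `p ∣ d_K` (place `v`) at which `E` has good reduction, Mathlib's
local polynomial of the twist `E^{(d_K)}` at `v` is `1`. From the ramified case of Artin formalism
`L_w(E_K) = L_v(E) · L_v(E^{(d_K)})` (`localPolynomialAt_baseChange_quadratic`; Ireland–Rosen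
Prop. 20.5.4(b)) by comparing degrees: `deg L_w ≤ 2 = deg L_v(E)`.
[cite: IrelandRosen1990, Ch. 20 §5, Prop. 20.5.4(b)] -/
theorem localPolynomialAt_quadraticTwist_discr_eq_one_of_dvd (h2 : Module.finrank ℚ K = 2)
    (v : HeightOneSpectrum (𝓞 ℚ)) (hv : ((primesEquiv v : ℕ) : ℤ) ∣ NumberField.discr K)
    (hgood : W.HasGoodReductionAt v) :
    (W.quadraticTwist (NumberField.discr K : ℚ)).localPolynomialAt v = 1 := by
  obtain ⟨w, hw, huniq, hf1⟩ := exists_unique_place_of_dvd_discr K h2 v hv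
  have hmul := (W.localPolynomialAt_baseChange_quadratic K h2 (v := v) (w := w) hw).2.2 huniq hf1
  set LD := (W.quadraticTwist (NumberField.discr K : ℚ)).localPolynomialAt v with hLD
  set Lv := W.localPolynomialAt v with hLv
  set Lw := (W.baseChange K).localPolynomialAt w with hLw
  have hLv0 : Lv ≠ 0 := fun h ↦ by
    have := coeff_zero_localPolynomialAt W v
    rw [← hLv, h, coeff_zero] at this
    exact zero_ne_one this
  have hLD0 : LD ≠ 0 := fun h ↦ by
    have := coeff_zero_localPolynomialAt (W.quadraticTwist (NumberField.discr K : ℚ)) v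
    rw [← hLD, h, coeff_zero] at this
    exact zero_ne_one this
  have hdegv : Lv.natDegree = 2 := by
    haveI : (W.baseChange (v.adicCompletion ℚ)).IsElliptic := by
      change (W.map _).IsElliptic; infer_instance
    exact natDegree_localPolynomial_of_hasGoodReduction _ hgood
  have hdegw : Lw.natDegree ≤ 2 := natDegree_localPolynomial_le_two _
  have hdeg : LD.natDegree = 0 := by
    have h := congrArg Polynomial.natDegree hmul
    rw [Polynomial.natDegree_mul hLv0 hLD0, hdegv] at h
    omega
  rw [Polynomial.eq_C_of_natDegree_eq_zero hdeg, hLD, coeff_zero_localPolynomialAt, map_one]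

/-- Consequently the local Euler factor of `E^{(d_K)}` at such a place is `1` (no Dirichlet
coefficient of `L(E^{(d_K)}, s)` at a multiple of `p` survives). [folklore] -/
theorem localEulerFactor_quadraticTwist_discr_eq_one_of_dvd (h2 : Module.finrank ℚ K = 2)
    (v : HeightOneSpectrum (𝓞 ℚ)) (hv : ((primesEquiv v : ℕ) : ℤ) ∣ NumberField.discr K)
    (hgood : W.HasGoodReductionAt v) :
    ((W.quadraticTwist (NumberField.discr K : ℚ)).baseChange (v.adicCompletion ℚ)).localEulerFactor
        (v.adicCompletionIntegers ℚ) = 1 := by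
  have hlp := W.localPolynomialAt_quadraticTwist_discr_eq_one_of_dvd K h2 v hv hgood
  rw [localPolynomialAt] at hlp
  have hps : ((W.quadraticTwist (NumberField.discr K : ℚ)).baseChange (v.adicCompletion ℚ)).localPowerSeries
      (v.adicCompletionIntegers ℚ) = 1 := by
    rw [localPowerSeries, hlp, Polynomial.coe_one]
    have h1 := PowerSeries.mul_invOfUnit (1 : PowerSeries ℤ) 1 (by simp)
    rwa [one_mul] at h1
  rw [localEulerFactor, hps, map_one]

end Twist

end WeierstrassCurve

end
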